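import Mathlib
import HarnessLib

/-!
# `Valuative.LuAlphaPTorsor`, line `pfaff-line-log-final-forms`: flag-adapted re-parametrization — gluing along a convex sublattice

Route `ResolutionOfSingularities/Valuative`, crux `Valuative.LuAlphaPTorsor`
(stmt-ResolutionOfSingularities-0641), line `pfaff-line-log-final-forms`, stub
`stub_adaptedUnimodular` (F¹, reshape v6.3). Second half of the ordered-group theory (independent
of `…AdaptedUnimodularHelpers.lean`): for a subgroup `L` of a linearly ordered abelian group `V`,
a basis `eL` of `L` with a level map, and top vectors `c j` independent and spanning modulo `L`,

* `adUni_combine_basis` / `adUni_glue_basis` — `eL` and the `c j` glue to a basis of `V`;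
* `adUni_combine_K1`, `adUni_combine_K2` — if `L` is CONVEX (everything outside dominates every
  multiple of everything inside) and the outside is one archimedean class, the glued basis, with
  the `c j` put on a new top level, inherits the two structural properties of a flag-adapted
  basis: (K1) a combination with a non-zero coordinate at a level `≥ ℓ` dominates all multiples
  of all combinations of the levels `< ℓ`; (K2) a combination of the levels `≤ ℓ` with a non-zero
  coordinate at level `ℓ` archimedean-dominates every combination of the levels `≤ ℓ`;
* `adUni_combine_repr` — non-negativity of coordinates glues;
* `adUni_reindex`, `adUni_clauses` — (K1), (K2) are stable under re-indexing and, with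
  positivity, yield the four clauses of `FlagAdaptedValues` in additive form ((C2a), (C2b), (C4)
  of `AdaptedValues` and the lattice-archimedean clause `LevelArchimedean`).
-/

set_option linter.dupNamespace false

namespace Summit.ResolutionOfSingularities.ResolutionOfSingularities.Theorems.PfaffLine

open Module

section Combine

variable {V : Type*} [AddCommGroup V] [LinearOrder V] [IsOrderedAddMonoid V]

omit [LinearOrder V] [IsOrderedAddMonoid V] in
/-- Translating a non-member by a member gives a non-member. -/
theorem adUni_add_not_mem {L : Submodule ℤ V} {v w : V} (hv : v ∉ L) (hw : w ∈ L) :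
    v + w ∉ L :=
  fun h => hv (by simpa using L.sub_mem h hw)

/-- The absolute value commutes with the inclusion of a subgroup. -/
theorem adUni_coe_abs {L : Submodule ℤ V} (y : L) : ((|y| : L) : V) = |(y : V)| := by
  rcases le_total 0 y with h | h
  · rw [abs_of_nonneg h, abs_of_nonneg]
    exact_mod_cast h
  · rw [abs_of_nonpos h, abs_of_nonpos]
    · simp
    · exact_mod_cast h


omit [LinearOrder V] [IsOrderedAddMonoid V] in
/-- Gluing a basis of `L` with top vectors that are independent and spanning modulo `L` gives a
basis of the whole lattice. -/
theorem adUni_combine_basis {L : Submodule ℤ V} {ιL : Type*} [Fintype ιL] (eL : Basis ιL ℤ L)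
    {t : ℕ} (c : Fin t → V) (hcind : ∀ μ : Fin t → ℤ, μ ≠ 0 → ∑ j, μ j • c j ∉ L)
    (hcspan : ∀ v, ∃ (μ : Fin t → ℤ) (w : V), w ∈ L ∧ v = ∑ j, μ j • c j + w) :
    ∃ e : Basis (ιL ⊕ Fin t) ℤ V, (∀ i, e (Sum.inl i) = eL i) ∧ (∀ j, e (Sum.inr j) = c j) := by
  classical
  have hcoe : ∀ a : ιL → ℤ, ((∑ i, a i • eL i : L) : V) = ∑ i, a i • (eL i : V) := fun a => by
    push_cast
    rfl
  have hli : LinearIndependent ℤ (Sum.elim (fun i => (eL i : V)) c) := by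
    rw [Fintype.linearIndependent_iff]
    intro a ha
    rw [Fintype.sum_sum_type] at ha
    simp only [Sum.elim_inl, Sum.elim_inr] at ha
    have hlow : (∑ i, a (Sum.inl i) • (eL i : V)) ∈ L := by
      rw [← hcoe]
      exact Submodule.coe_mem _
    have hinr : ∀ j, a (Sum.inr j) = 0 := by
      by_contra hne
      push Not at hne
      have hne' : (fun j => a (Sum.inr j)) ≠ 0 := by
        obtain ⟨j, hj⟩ := hne
        exact fun h => hj (congrFun h j)
      refine hcind _ hne' ?_
      rw [eq_neg_of_add_eq_zero_right ha]
      exact L.neg_mem hlow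
    simp only [hinr, zero_smul, Finset.sum_const_zero, add_zero] at ha
    have hinl : ∀ i, a (Sum.inl i) = 0 := by
      have h2 : ∑ i, a (Sum.inl i) • eL i = 0 := by
        rw [← Submodule.coe_eq_zero, hcoe]
        exact ha
      exact fun i => Fintype.linearIndependent_iff.mp eL.linearIndependent _ h2 i
    rintro (i | j)
    exacts [hinl i, hinr j]
  have hsp : ⊤ ≤ Submodule.span ℤ (Set.range (Sum.elim (fun i => (eL i : V)) c)) := by
    intro v _
    obtain ⟨μ, w, hw, rfl⟩ := hcspan v
    refine Submodule.add_mem _ (Submodule.sum_mem _ fun j _ =>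
      Submodule.smul_mem _ _ (Submodule.subset_span ⟨Sum.inr j, rfl⟩)) ?_
    have : w = ∑ i, eL.repr ⟨w, hw⟩ i • (eL i : V) := by
      rw [← hcoe, eL.sum_repr]
    rw [this]
    exact Submodule.sum_mem _ fun i _ =>
      Submodule.smul_mem _ _ (Submodule.subset_span ⟨Sum.inl i, rfl⟩)
  exact ⟨Basis.mk hli hsp, fun i => by rw [Basis.mk_apply, Sum.elim_inl],
    fun j => by rw [Basis.mk_apply, Sum.elim_inr]⟩

omit [LinearOrder V] [IsOrderedAddMonoid V] in
/-- Splitting a combination of the glued family into its low and top parts. -/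
theorem adUni_combine_sum {L : Submodule ℤ V} {ιL : Type*} [Fintype ιL] (eL : Basis ιL ℤ L)
    {t : ℕ} (c : Fin t → V) (e : ιL ⊕ Fin t → V) (hinl : ∀ i, e (Sum.inl i) = eL i)
    (hinr : ∀ j, e (Sum.inr j) = c j) (a : ιL ⊕ Fin t → ℤ) :
    ∑ k, a k • e k = ((∑ i, a (Sum.inl i) • eL i : L) : V) + ∑ j, a (Sum.inr j) • c j := by
  rw [Fintype.sum_sum_type]
  push_cast
  simp only [hinl, hinr]

omit [LinearOrder V] [IsOrderedAddMonoid V] in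
/-- Coordinates of an `ℕ`-combination of the top vectors plus a low element with non-negative
low coordinates are non-negative. -/
theorem adUni_combine_repr {L : Submodule ℤ V} {ιL : Type*} [Fintype ιL] (eL : Basis ιL ℤ L)
    {t : ℕ} (c : Fin t → V) (e : Basis (ιL ⊕ Fin t) ℤ V) (hinl : ∀ i, e (Sum.inl i) = eL i)
    (hinr : ∀ j, e (Sum.inr j) = c j) (d : V) (E : Fin t → ℕ) (res : V) (hres : res ∈ L)
    (hresrepr : ∀ i, 0 ≤ eL.repr ⟨res, hres⟩ i)
    (hd : d = ∑ j, ((E j : ℕ) : ℤ) • c j + res) : ∀ k, 0 ≤ e.repr d k := by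
  classical
  set a : ιL ⊕ Fin t → ℤ := Sum.elim (fun i => eL.repr ⟨res, hres⟩ i) (fun j => (E j : ℤ))
    with ha
  have hda : d = ∑ k, a k • e k := by
    rw [adUni_combine_sum eL c e hinl hinr a, hd, add_comm]
    simp only [ha, Sum.elim_inl, Sum.elim_inr, eL.sum_repr]
  intro k
  rw [hda, e.repr_sum_self]
  rcases k with i | j
  · exact hresrepr i
  · simp [ha]

/-- Convexity of the lower levels (property K1) for the glued family. -/
theorem adUni_combine_K1 {L : Submodule ℤ V}
    (hlowlt : ∀ v, v ∉ L → ∀ w, w ∈ L → ∀ N : ℕ, N • |w| < |v|)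
    {ιL : Type*} [Fintype ιL] (eL : Basis ιL ℤ L) (lvL : ιL → ℕ) (M : ℕ) (hM : ∀ i, lvL i < M)
    {t : ℕ} (c : Fin t → V) (hcind : ∀ μ : Fin t → ℤ, μ ≠ 0 → ∑ j, μ j • c j ∉ L)
    (e : ιL ⊕ Fin t → V) (hinl : ∀ i, e (Sum.inl i) = eL i) (hinr : ∀ j, e (Sum.inr j) = c j)
    (hK1L : ∀ (ℓ : ℕ) (m μ : ιL → ℤ), (∀ j, ℓ ≤ lvL j → m j = 0) →
      (∃ j, ℓ ≤ lvL j ∧ μ j ≠ 0) → ∀ N : ℕ, N • |∑ j, m j • eL j| < |∑ j, μ j • eL j|) :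
    ∀ (ℓ : ℕ) (m μ : ιL ⊕ Fin t → ℤ), (∀ j, ℓ ≤ Sum.elim lvL (fun _ => M) j → m j = 0) →
      (∃ j, ℓ ≤ Sum.elim lvL (fun _ => M) j ∧ μ j ≠ 0) →
      ∀ N : ℕ, N • |∑ j, m j • e j| < |∑ j, μ j • e j| := by
  intro ℓ m μ hm hμ N
  obtain ⟨j₀, hj₀, hμj₀⟩ := hμ
  have hℓM : ℓ ≤ M := by
    rcases j₀ with i | j
    · exact (hj₀.trans (hM i).le)
    · exact hj₀
  have hm_inr : ∀ j, m (Sum.inr j) = 0 := fun j => hm (Sum.inr j) hℓM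
  have hxm : ∑ k, m k • e k = ((∑ i, m (Sum.inl i) • eL i : L) : V) := by
    rw [adUni_combine_sum eL c e hinl hinr m]
    simp [hm_inr]
  have hxm_mem : ∑ k, m k • e k ∈ L := by rw [hxm]; exact Submodule.coe_mem _
  by_cases hμinr : (fun j => μ (Sum.inr j)) = 0
  · have hμ_inr : ∀ j, μ (Sum.inr j) = 0 := fun j => congrFun hμinr j
    have hxμ : ∑ k, μ k • e k = ((∑ i, μ (Sum.inl i) • eL i : L) : V) := by
      rw [adUni_combine_sum eL c e hinl hinr μ]
      simp [hμ_inr]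
    rcases j₀ with i₀ | j
    · have h := hK1L ℓ (fun i => m (Sum.inl i)) (fun i => μ (Sum.inl i))
        (fun i hi => hm (Sum.inl i) hi) ⟨i₀, hj₀, hμj₀⟩ N
      rw [hxm, hxμ, ← adUni_coe_abs, ← adUni_coe_abs]
      exact_mod_cast h
    · exact absurd (hμ_inr j) hμj₀
  · have hxμ : ∑ k, μ k • e k ∉ L := by
      rw [adUni_combine_sum eL c e hinl hinr μ, add_comm]
      exact adUni_add_not_mem (hcind _ hμinr) (Submodule.coe_mem _)
    exact hlowlt _ hxμ _ hxm_mem N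

/-- Archimedeanity of each level modulo the lower ones (property K2) for the glued family. -/
theorem adUni_combine_K2 {L : Submodule ℤ V}
    (harch : ∀ v, v ∉ L → ∀ w, ∃ N : ℕ, |w| ≤ N • |v|)
    {ιL : Type*} [Fintype ιL] (eL : Basis ιL ℤ L) (lvL : ιL → ℕ) (M : ℕ) (hM : ∀ i, lvL i < M)
    {t : ℕ} (c : Fin t → V) (hcind : ∀ μ : Fin t → ℤ, μ ≠ 0 → ∑ j, μ j • c j ∉ L)
    (e : ιL ⊕ Fin t → V) (hinl : ∀ i, e (Sum.inl i) = eL i) (hinr : ∀ j, e (Sum.inr j) = c j)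
    (hK2L : ∀ (ℓ : ℕ) (μ μ' : ιL → ℤ), (∀ j, ℓ < lvL j → μ j = 0) →
      (∃ j, lvL j = ℓ ∧ μ j ≠ 0) → (∀ j, ℓ < lvL j → μ' j = 0) →
      ∃ N : ℕ, |∑ j, μ' j • eL j| ≤ N • |∑ j, μ j • eL j|) :
    ∀ (ℓ : ℕ) (μ μ' : ιL ⊕ Fin t → ℤ), (∀ j, ℓ < Sum.elim lvL (fun _ => M) j → μ j = 0) →
      (∃ j, Sum.elim lvL (fun _ => M) j = ℓ ∧ μ j ≠ 0) →
      (∀ j, ℓ < Sum.elim lvL (fun _ => M) j → μ' j = 0) →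
      ∃ N : ℕ, |∑ j, μ' j • e j| ≤ N • |∑ j, μ j • e j| := by
  intro ℓ μ μ' hμ hμ0 hμ'
  by_cases hμinr : (fun j => μ (Sum.inr j)) = 0
  · have hμ_inr : ∀ j, μ (Sum.inr j) = 0 := fun j => congrFun hμinr j
    obtain ⟨j₀, hj₀, hμj₀⟩ := hμ0
    rcases j₀ with i₀ | j
    · have hℓM : ℓ < M := by rw [← hj₀]; exact hM i₀
      have hμ'_inr : ∀ j, μ' (Sum.inr j) = 0 := fun j => hμ' (Sum.inr j) hℓM
      have hxμ : ∑ k, μ k • e k = ((∑ i, μ (Sum.inl i) • eL i : L) : V) := by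
        rw [adUni_combine_sum eL c e hinl hinr μ]
        simp [hμ_inr]
      have hxμ' : ∑ k, μ' k • e k = ((∑ i, μ' (Sum.inl i) • eL i : L) : V) := by
        rw [adUni_combine_sum eL c e hinl hinr μ']
        simp [hμ'_inr]
      obtain ⟨N, hN⟩ := hK2L ℓ (fun i => μ (Sum.inl i)) (fun i => μ' (Sum.inl i))
        (fun i hi => hμ (Sum.inl i) hi) ⟨i₀, hj₀, hμj₀⟩ (fun i hi => hμ' (Sum.inl i) hi)
      refine ⟨N, ?_⟩
      rw [hxμ, hxμ', ← adUni_coe_abs, ← adUni_coe_abs]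
      exact_mod_cast hN
    · exact absurd (hμ_inr j) hμj₀
  · have hxμ : ∑ k, μ k • e k ∉ L := by
      rw [adUni_combine_sum eL c e hinl hinr μ, add_comm]
      exact adUni_add_not_mem (hcind _ hμinr) (Submodule.coe_mem _)
    exact harch _ hxμ _

end Combine

section Clauses

variable {V : Type*} [AddCommGroup V] [LinearOrder V] [IsOrderedAddMonoid V]

omit [IsOrderedAddMonoid V] in
/-- Properties (K1), (K2) are stable under re-indexing the family. -/
theorem adUni_reindex {ι κ : Type*} [Fintype ι] [Fintype κ] (σ : ι ≃ κ) (e : ι → V)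
    (lv : ι → ℕ)
    (hK1 : ∀ (ℓ : ℕ) (m μ : ι → ℤ), (∀ j, ℓ ≤ lv j → m j = 0) → (∃ j, ℓ ≤ lv j ∧ μ j ≠ 0) →
      ∀ N : ℕ, N • |∑ j, m j • e j| < |∑ j, μ j • e j|)
    (hK2 : ∀ (ℓ : ℕ) (μ μ' : ι → ℤ), (∀ j, ℓ < lv j → μ j = 0) → (∃ j, lv j = ℓ ∧ μ j ≠ 0) →
      (∀ j, ℓ < lv j → μ' j = 0) → ∃ N : ℕ, |∑ j, μ' j • e j| ≤ N • |∑ j, μ j • e j|) :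
    (∀ (ℓ : ℕ) (m μ : κ → ℤ), (∀ j, ℓ ≤ lv (σ.symm j) → m j = 0) →
      (∃ j, ℓ ≤ lv (σ.symm j) ∧ μ j ≠ 0) →
      ∀ N : ℕ, N • |∑ j, m j • e (σ.symm j)| < |∑ j, μ j • e (σ.symm j)|) ∧
    (∀ (ℓ : ℕ) (μ μ' : κ → ℤ), (∀ j, ℓ < lv (σ.symm j) → μ j = 0) →
      (∃ j, lv (σ.symm j) = ℓ ∧ μ j ≠ 0) → (∀ j, ℓ < lv (σ.symm j) → μ' j = 0) →
      ∃ N : ℕ, |∑ j, μ' j • e (σ.symm j)| ≤ N • |∑ j, μ j • e (σ.symm j)|) := by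
  have hsum : ∀ m : κ → ℤ, ∑ j, m j • e (σ.symm j) = ∑ i, m (σ i) • e i := fun m => by
    rw [← Equiv.sum_comp σ]
    simp only [Equiv.symm_apply_apply]
  constructor
  · intro ℓ m μ hm hμ N
    obtain ⟨j₀, hj₀, hμj₀⟩ := hμ
    rw [hsum, hsum]
    refine hK1 ℓ (fun i => m (σ i)) (fun i => μ (σ i)) (fun i hi => hm (σ i) (by simpa using hi))
      ⟨σ.symm j₀, hj₀, by simpa using hμj₀⟩ N
  · intro ℓ μ μ' hμ hμ0 hμ'
    obtain ⟨j₀, hj₀, hμj₀⟩ := hμ0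
    rw [hsum, hsum]
    exact hK2 ℓ (fun i => μ (σ i)) (fun i => μ' (σ i)) (fun i hi => hμ (σ i) (by simpa using hi))
      ⟨σ.symm j₀, hj₀, by simpa using hμj₀⟩ (fun i hi => hμ' (σ i) (by simpa using hi))

/-- From (K1), (K2) and positivity to the four clauses of a flag-adapted family (additive
form, positive convention): (C2a) a member of higher level dominates every combination of
members of lower-or-equal level than a given lower one; (C2b) two members of one level are
archimedean-comparable; (C4) a non-trivial combination of members of level `ℓ` is above or below
all combinations of lower levels; (LA) a combination of members of one level `ℓ` dominating all
combinations of lower levels archimedean-dominates every combination of level `ℓ`. -/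
theorem adUni_clauses {ι : Type*} [Fintype ι] (e : ι → V) (lv : ι → ℕ) (hpos : ∀ i, 0 < e i)
    (hK1 : ∀ (ℓ : ℕ) (m μ : ι → ℤ), (∀ j, ℓ ≤ lv j → m j = 0) → (∃ j, ℓ ≤ lv j ∧ μ j ≠ 0) →
      ∀ N : ℕ, N • |∑ j, m j • e j| < |∑ j, μ j • e j|)
    (hK2 : ∀ (ℓ : ℕ) (μ μ' : ι → ℤ), (∀ j, ℓ < lv j → μ j = 0) → (∃ j, lv j = ℓ ∧ μ j ≠ 0) →
      (∀ j, ℓ < lv j → μ' j = 0) → ∃ N : ℕ, |∑ j, μ' j • e j| ≤ N • |∑ j, μ j • e j|) :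
    (∀ i i', lv i < lv i' → ∀ m : ι → ℤ, (∀ j, lv i < lv j → m j = 0) →
      ∑ j, m j • e j < e i') ∧
    (∀ i i', lv i = lv i' → ∃ N : ℕ, e i' < N • e i) ∧
    (∀ (ℓ : ℕ) (μ : ι → ℤ), (∀ j, lv j ≠ ℓ → μ j = 0) → μ ≠ 0 →
      (∀ m : ι → ℤ, (∀ j, ℓ ≤ lv j → m j = 0) → ∑ j, m j • e j < ∑ j, μ j • e j) ∨
      (∀ m : ι → ℤ, (∀ j, ℓ ≤ lv j → m j = 0) → ∑ j, μ j • e j < ∑ j, m j • e j)) ∧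
    (∀ (ℓ : ℕ) (μ μ' : ι → ℤ), (∀ j, lv j ≠ ℓ → μ j = 0) → (∀ j, lv j ≠ ℓ → μ' j = 0) →
      (∀ m : ι → ℤ, (∀ j, ℓ ≤ lv j → m j = 0) → ∑ j, m j • e j < ∑ j, μ j • e j) →
      ∃ N : ℕ, ∑ j, μ' j • e j < N • ∑ j, μ j • e j) := by
  classical
  have hsingle : ∀ i, ∑ j, (Pi.single i (1 : ℤ) : ι → ℤ) j • e j = e i := fun i => by
    simp [Pi.single_apply]
  refine ⟨?_, ?_, ?_, ?_⟩
  · intro i i' hii' m hm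
    have h := hK1 (lv i + 1) m (Pi.single i' 1) (fun j hj => hm j hj) ⟨i', hii', by simp⟩ 1
    rw [one_nsmul, hsingle, abs_of_pos (hpos i')] at h
    exact (le_abs_self _).trans_lt h
  · intro i i' hii'
    obtain ⟨N, hN⟩ := hK2 (lv i) (Pi.single i 1) (Pi.single i' 1)
      (fun j hj => by
        rw [Pi.single_apply, if_neg]
        rintro rfl
        exact lt_irrefl _ hj)
      ⟨i, rfl, by simp⟩
      (fun j hj => by
        rw [Pi.single_apply, if_neg]
        rintro rfl
        rw [hii'] at hj
        exact lt_irrefl _ hj)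
    rw [hsingle, hsingle, abs_of_pos (hpos i), abs_of_pos (hpos i')] at hN
    refine ⟨N + 1, hN.trans_lt ?_⟩
    rw [add_nsmul, one_nsmul]
    exact lt_add_of_pos_right _ (hpos i)
  · intro ℓ μ hμ hμ0
    have hμne : ∃ j, ℓ ≤ lv j ∧ μ j ≠ 0 := by
      by_contra hne
      push Not at hne
      refine hμ0 (funext fun j => ?_)
      by_cases hj : lv j = ℓ
      · exact hne j hj.ge
      · exact hμ j hj
    have hkey : ∀ m : ι → ℤ, (∀ j, ℓ ≤ lv j → m j = 0) →
        |∑ j, m j • e j| < |∑ j, μ j • e j| := fun m hm => by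
      have h := hK1 ℓ m μ hm hμne 1
      rwa [one_nsmul] at h
    rcases lt_or_gt_of_ne (show (∑ j, μ j • e j) ≠ 0 from fun h0 => by
      have := hkey 0 (fun _ _ => rfl)
      rw [h0] at this
      simp at this) with hneg | hposμ
    · right
      intro m hm
      have h := hkey m hm
      rw [abs_of_neg hneg] at h
      exact (lt_neg.mp h).trans_le (neg_abs_le _)
    · left
      intro m hm
      have h := hkey m hm
      rw [abs_of_pos hposμ] at h
      exact (le_abs_self _).trans_lt h
  · intro ℓ μ μ' hμ hμ' hlow
    have hμpos : 0 < ∑ j, μ j • e j := by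
      have := hlow 0 (fun _ _ => rfl)
      simpa using this
    have hμne : ∃ j, lv j = ℓ ∧ μ j ≠ 0 := by
      by_contra hne
      push Not at hne
      have : μ = 0 := funext fun j => by
        by_cases hj : lv j = ℓ
        · exact hne j hj
        · exact hμ j hj
      subst this
      simp at hμpos
    obtain ⟨N, hN⟩ := hK2 ℓ μ μ' (fun j hj => hμ j (Nat.ne_of_gt hj)) hμne
      (fun j hj => hμ' j (Nat.ne_of_gt hj))
    refine ⟨N + 1, ?_⟩
    rw [abs_of_pos hμpos] at hN
    calc ∑ j, μ' j • e j ≤ |∑ j, μ' j • e j| := le_abs_self _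
      _ ≤ N • ∑ j, μ j • e j := hN
      _ < (N + 1) • ∑ j, μ j • e j := by
        rw [add_nsmul, one_nsmul]
        exact lt_add_of_pos_right _ hμpos

end Clauses

section Anchor

/-- **Gluing bases along a sublattice** (registered form of `adUni_combine_basis`): a basis of
a subgroup `L` together with vectors that are independent modulo `L` and span modulo `L` is a
basis of the whole group. [folklore] -/
theorem adUni_glue_basis : ∀ (V : Type) [AddCommGroup V] (L : Submodule ℤ V) (ιL : Type) [Fintype ιL] (eL : Module.Basis ιL ℤ L) (t : ℕ) (c : Fin t → V), (∀ μ : Fin t → ℤ, μ ≠ 0 → ∑ j, μ j • c j ∉ L) → (∀ v, ∃ (μ : Fin t → ℤ) (w : V), w ∈ L ∧ v = ∑ j, μ j • c j + w) → ∃ e : Module.Basis (ιL ⊕ Fin t) ℤ V, (∀ i, e (Sum.inl i) = eL i) ∧ (∀ j, e (Sum.inr j) = c j) :=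
  fun _ _ _ _ _ eL _ c hcind hcspan => adUni_combine_basis eL c hcind hcspan

end Anchor

end Summit.ResolutionOfSingularities.ResolutionOfSingularities.Theorems.PfaffLine
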